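import Summits.QuantumFields.YangMills.Theorems.BalabanUVNodesN22AtGeneratedHistory13
import Summits.QuantumFields.YangMills.Theorems.BalabanUVNodesN22EdgeAtW1AdmReadingOfRecord13CoPH
import Summits.QuantumFields.YangMills.Theorems.BalabanUVNodesN22AtGeneratedHistory12Below

/-!
# v1.7 `CoPH` EDITION (HISTORY-INDEXED RESIDUAL 𝐓-WEIGHTS, FINDING №9) of 8c″ — the `CoPR ↦ CoPH` image of this seat's v1.6 module `BalabanUVNodesN22AtGeneratedHistory13CoPR` (p540033), itself the
# `CoP ↦ CoPR` image of the v1.5 module (FINDING №8); role and decl list = the ‴ header of record below under T₇ ∘ T₆.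
#
# WHY THIS FILE EXISTS (director-ym LINE №183 RULING H1ʰ ∕ №186 (α) ∕ №187 FILING GATES CLEARED, pub-ymgap INBOX l.20100 ∕ l.20321 ∕ l.20335; def-T LOCATED-9
# «HISTORY-BLIND RESIDUAL 𝐓-WEIGHT SLOT»: v1.6's run-indexed slot `Stage13RParams.Zr p` is still NARROWER than print — print's ζ(Ω^c_{k+1}) ([Balaban1988Convergent] p.257
# L31–34, p.267, (3.2)–(3.5), (3.23) p.270) is built from THE TERM's history (Ω, Λ, …); FINDING-№8 class one index further on the same axis).  def-T's FILE 27
# `Node00/Record13CoPH` (p537939) introduced `structure Stage13HParams extends Stage13RParams` with ONE new HISTORY-INDEXED field `Zh`, the guard `Stage13HParams.ZhUnity`,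
# the proviso core `Stage13HParams.Provisos₁₃CoPH` (rows `zhLaws ∕ zhLocal` replacing `zrLaws ∕ zrLocal`), the datum `datumOfRecord₁₃CoPH`, the record class
# `IsRecordOfRecord₁₃CCoPH` and the one-way history-blind door `Stage13HParams.ofHistoryBlind` from v1.6; RR-2 re-keyed the datum key on it (`Node00/Record13DatumKeyCoPH`, p539151:
# `IsDatumOfRecord₁₃CCoPH ∕ CCoPHOn ∕ CCoPHN`, `IsRecordOfRecord₁₃CCoPHOn ∕ CCoPHN`, the guard of record `unityNondeg₁₃H`); plan presses rev 24 (⁷ = T₇(⁶), K3⁷ `SpineGivenEndpointR13SepCoPH`).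
# A theorem binding `θ : Stage13RParams` cannot be applied at a `Stage13HParams` item tuple's datum, so every storey typed `∀ (θ : Stage13RParams F N) (hc :
# θ.Provisos₁₃CoPR F N), …` is re-keyed ONCE MORE; this file is the (T-RATE) pen's image of its own v1.6 module under def-T's KEY-RULE (T₇), token for token:
#   binder `Stage13RParams ↦ Stage13HParams` (readings `lit ∕ ne1`, residual maps `w1 ∕ ℓ₃ ∕ ne2`, regimes `Rg`, selectors `ksel`, tower families are typed over
#   `Stage13HParams`) · `θ.Provisos₁₃CoPR ↦ θ.Provisos₁₃CoPH` · `datumOfRecord₁₃CoPR ↦ datumOfRecord₁₃CoPH` · `(Is|is)(Datum|Record)OfRecord₁₃CCoPR(On|N) ↦ …₁₃CCoPH(On|N)` ·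
#   guard `θ.ZrUnity ↦ θ.ZhUnity`, `Node00.unityNondeg₁₃R ↦ Node00.unityNondeg₁₃H` · THIS seat's stems `…₁₃CoPR… ↦ …₁₃CoPH…` (`RateReading₁₃CoPH`, `rateCarriersOfRecord₁₃CoPH`,
#   `RRec₁₃CoPH(On)`, `rRec₁₃CoPH…`, `readingOfRecord₁₃CoPH`, `…datumKey₁₃CoPH…`, `n22_tupleReadingOfRecordCoPH(On)…`; the unity-regime example face `…_zrUnity_iff ↦ …_zhUnity_iff`)
#   and module names `…13CoPR… ↦ …13CoPH…`.  NO new SITE-RULE: this lineage reads no 𝐓-weight slot; the θ-only ‴ bundle and closers (`u3OfRecord₁₃`, its faces,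
#   `n22At_u3OfRecord₁₃_…`) and RR-2's `RateAssignment₁₃` stay applied at `θ.toStage13Params` exactly as in v1.6 (the parent view resolves through the two `extends`
#   levels; `θ.toStage12Params ∕ θ.γ ∕ θ.L`, `θ.Admissible F N`, `θ.SlotsNondegenerate₁₃ F N` likewise — unchanged text).
# Statements = the v1.6 statements under the map, proofs = the v1.6 proofs verbatim (kernel re-derivations BY NAME); the ‴ ∕ ⁗ ∕ Co ∕ CoP ∕ CoPR editions of this module
# stay in the tree as the aside items' context (nothing landed is edited or re-declared).  bg-BLIND and 𝐓-WEIGHT-BLIND as before — which is why the port is a token map.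
#
# ITEM IDS: crux names ∕ item ids quoted in the ‴ header of record below are those of EARLIER revisions, asides now; this file is filed `--supports stmt-QuantumFields-20544`
# (K3⁷ `SpineGivenEndpointR13SepCoPH`, the K3 item of record per dag-lead WORDS-143 (pub-ymgap INBOX l.20907, rev 24∕25)) as a HELPER — count-neutral, no stub closed, N22 NOT discharged, no inhabitant of any key claimed (K0 OPEN at every edition), nothing of Bałaban
# asserted; one finite 𝕋⁴ programme at fixed ε — NOT continuum ∕ OS ∕ mass-gap ∕ Clay.
#
# ‴ HEADER OF RECORD FOLLOWS (token-mapped; its decl lists are this file's, the θ-only names above excepted):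
#
# BalabanUVNodes ∕ node N22 AT THE ADMISSIBLE W1 READING OF THE STAGE-13 RECORD ON node00-def-W1's GENERATED RUN TOWERS `runTowers (fun k ↦ toClusterTower (G k))` —
# the SHARP SCHEMA PACKAGE at Stage 13: `S_N22 (RRec₁₃CoPH 𝔯)` ∕ `S_N22 (RRec₁₃CoPHOn 𝔯 Rg)` at every Stage-13 reading pinned to the admissible reading on the generated towers, and at
# the Stage-13 reading of record (module 6″) with the `ofRecordAdm` ∕ `ofRecordGen` W1 component ⟸ `S_N18` at the same reading + W1's per-step analyticity schemas BELOW the run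
# length + ONE displayed complex sup-letter inequality + numerals ((J), coherence, readings ∕ transport clauses all discharged by construction)

Track A of `YM-PLAN.md` (cell `pub-ymgap`, HUMAN RULING D-0062), R134 seat `pub-ymgap-dag-n22-e` (s2 «`FadingMemory` by name from a modulus + knit at the record»), gen 5,
module 8c″ = the Stage-13 twin (`12 ↦ 13`) of the lineage's module 8c `…N22AtGeneratedHistory12Below.lean` (p489855) at the record OF RECORD (director-ym LINE №125 ∕ №133 ∕ №135;
route rev 17, K3‴ `SpineGivenEndpointR13` = stmt-QuantumFields-19912; dag-lead WORDS-133 ∕ 134 ∕ 135), with the stub level GENERALISED (like 9″c ∕ 7″) to every Stage-13 reading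
carrying the W1 pin `hpin`.  THEOREMS ONLY; imports 8a″ (`…N22EdgeAtW1AdmReadingOfRecord13`, which brings 7″ ∕ 6″ ∕ 9″c ∕ layer B at ₁₃) and module 8c (for its STAGE-FREE §1–§2
`supLetterA_truncRun_toClusterTower_of_holo ∕ _of_schemasBelow` and node00-def-W1's `Node00/HistoryRecursionOfRecord` v1.2 ∕ `RateRecordW1MapsAdm` it brings — reused, not
re-declared); every proof is ONE application BY NAME; the Stage-13 bundle IS the Stage-12 bundle of the parent tuple (`u3OfRecord₁₃_eq_u3OfRecord₁₂`, `rfl`).  The generator `G`,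
tables `sp`, strict class `Pplus`, transport `T₀`, gauge, letters `li` and the residual components `ne2 ∕ ne1` are read PER STAGE-13 TUPLE.  Restate-immune (no Theses import);
COUNT-NEUTRAL; `--supports` K3‴ as a helper.

WHAT IS KERNEL-CHECKED ([folklore]; 0 `def`, 0 `sorry`).
* §1 `n22At_u3OfRecord₁₃_ofRecordAdm_gen_of_n18Below_schemasBelow` (θ-form at one Stage-13 tuple on the generated run towers, sharp package).
* §2 `s_N22_rRec₁₃CoPH_w1_gen_of_s_N18_schemasBelow` (ANY `hpin`-reading, canonical home) · `s_N22_rRec₁₃CoPHOn_w1_gen_of_s_N18_schemasBelow` (regime home) ·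
  `s_N22_readingOfRecord₁₃CoPH_gen_of_s_N18_schemasBelow` · `s_N22_readingOfRecord₁₃CoPHOn_gen_of_s_N18_schemasBelow` (the reading of record, `hpin := rfl`).
* §3 at W1's GENERATED tables `spGen` (`ReadingData.ofRecordGen`; the transport clause is W1's theorem `hT₀_spGen`): `n22At_u3OfRecord₁₃_ofRecordGen_gen_of_n18Below_schemasBelow` ·
  `s_N22_readingOfRecord₁₃CoPH_ofRecordGen_gen_of_s_N18_schemasBelow` · `s_N22_readingOfRecord₁₃CoPHOn_ofRecordGen_gen_of_s_N18_schemasBelow`.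
* §4 IN THE K3‴ SKELETON's CURRENCY: `n22_tupleReadingOfRecordCoPH_gen_of_n18Below_schemasBelow` (N22's conjunct of `KeyedRates rr` at the level-selected tuple reading of
  record `rr := fun F θ hP g₀ os ↦ rateCarriersOfRecord₁₃CoPH (readingOfRecord₁₃CoPH …) F θ hP g₀ os (ksel F θ g₀ os)`, unguarded binder) · `n22_tupleReadingOfRecordCoPHOn_gen_…` (guarded, any `Rg`).

HONEST FRAMING.  N22's OWN displayed residual at this reading is ONE inequality schema on the object — the complex sup letter `‖recTerm (G k) (g[i ↦ z]) j X φ‖ ≤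
li.A·li.μ^{j−1−i}·e^{−li.κ d_j X}` for `z` in a conj-symmetric open `Dk ⊇` the closed `li.r`-discs ((1.18) at COMPLEX values of one young coupling, NOT PRINTED) — plus W1's two
qualitative per-step schemas and `RecAdmissible` below the run length, `S_N18` at the same reading (dag-n18-d's lane) and numerals; the generator OF RECORD `G` is a PARAMETER
(node00-def-W1 ∕ def-B13 lanes); nothing of Bałaban's is asserted or instantiated — NE5 ∕ NE9 NOT PRINTED for d = 4 and NOT PROVED; no inhabitant of `IsDatumOfRecord₁₃CCoPH` claimed
(K0‴ `Record13Inhabited`, stmt-QuantumFields-19909, OPEN); N22 NOT discharged; counts UNMOVED (typed 28∕28 · discharged 5∕27, A 5∕28); one finite four-torus programme at fixed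
`ε` — NOT ℝ⁴, NOT infinite volume, NOT OS, NOT a mass gap, NOT Clay.  No decl below carries a cite tag.
-/

noncomputable section

namespace YMDAG.N22

open Set Metric ComplexConjugate
open scoped BigOperators
open Literature.MathematicalPhysics.QuantumFieldTheory.Balaban1983to89
open Literature.MathematicalPhysics.QuantumFieldTheory.Balaban1983to89.T4Continuum
open Literature.MathematicalPhysics.QuantumFieldTheory.Balaban1983to89.T4OutputRate
open Literature.MathematicalPhysics.QuantumFieldTheory.Balaban1983to89.Node00
  (Stage13HParams NE2Objects₁₁ NE3Letters₁₁ MatA ιSU)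
open Literature.MathematicalPhysics.QuantumFieldTheory.Balaban1983to89.Node00.Sect2 (domSys CPair ofBackgroundC)
open Literature.MathematicalPhysics.QuantumFieldTheory.Balaban1983to89.Node00.W1
open YMDAG.UVSplit

variable {N : ℕ} [NeZero N]

/-! ## §2 Stub level: any `hpin`-reading, and the Stage-13 reading of record -/

section Stub

variable (G : (F : T4Family) → (θ : Stage13HParams F N) → (k : ℕ) → GenTower (F.P k) (MatA N) θ.τ9.M)
  (sp : (F : T4Family) → (θ : Stage13HParams F N) → (k j : ℕ) → (domSys (F.P k) θ.τ9.M j).Dom → Set (CPair (F.P k) (MatA N)))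
  (gauge : (F : T4Family) → (θ : Stage13HParams F N) → (k : ℕ) → GaugeField (F.P k) 0 (Node00.SU N) → GaugeField (F.P k) 0 (Node00.SU N) → ℝ)
  (hg : ∀ (F : T4Family) (θ : Stage13HParams F N) (k : ℕ) (U U' : GaugeField (F.P k) 0 (Node00.SU N)), 0 ≤ gauge F θ k U U')
  (T₀ : (F : T4Family) → (θ : Stage13HParams F N) → (k : ℕ) → GaugeField (F.P (k + 1)) 0 (Node00.SU N) → GaugeField (F.P k) 0 (Node00.SU N))
  (hT₀ : ∀ (F : T4Family) (θ : Stage13HParams F N) (k : ℕ) (U : GaugeField (F.P (k + 1)) 0 (Node00.SU N)),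
    (∀ (j : ℕ) (Y : (domSys (F.P (k + 1)) θ.τ9.M j).Dom), ofBackgroundC (ιSU N) U ∈ sp F θ (k + 1) j Y) →
    ∀ (j : ℕ) (Y : (domSys (F.P k) θ.τ9.M j).Dom), ofBackgroundC (ιSU N) (T₀ F θ k U) ∈ sp F θ k j Y)
  (li : (F : T4Family) → Stage13HParams F N → LetterInputs)
  (ne1 : (F : T4Family) → Stage13HParams F N → (ℕ → ℝ) → List (ULoop F) → NE1pCarriers)

/-- **`S_N22` AT THE CANONICAL STAGE-13 HOME FROM `S_N18` AND THE SHARP SCHEMA PACKAGE**, for ANY Stage-13 reading `𝔯` whose node-U3 objects ARE the admissible W1 reading on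
the generated run towers (`hpin`, ONE pointwise equation — `rfl` at the reading of record below): `S_N18 (RRec₁₃CoPH 𝔯)` + per admissible Stage-13 tuple with provisos and run length
`k` the sharp package (a conj-symmetric open `Dk ⊇` the closed `li.r`-discs about `]0, θ.γ]`, admissible older-term classes, (A-last)ₘ ∕ (A-prop)ₘ for the steps `m < k`, the
complex sup letter for the levels `j ≤ k`) + the eleven numerals ⟹ `S_N22 (RRec₁₃CoPH 𝔯)` — §1's θ-form at every datum key and run length (9″c's `s_N22_rRec₁₃CoPH_w1_iff`). [folklore] -/
theorem s_N22_rRec₁₃CoPH_w1_gen_of_s_N18_schemasBelow (𝔯 : RateReading₁₃CoPH N)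
    (hpin : ∀ (F : T4Family) (θ : Stage13HParams F N) (hP : θ.Provisos₁₃CoPH F N) (g₀ : ℕ → ℝ) (os : List (ULoop F)), (𝔯.lit F θ hP g₀ os).u3 =
      (ReadingData.ofRecordAdm F θ.τ9.M N (runTowers fun k => toClusterTower (G F θ k)) (sp F θ) (gauge F θ) (hg F θ) (T₀ F θ) (hT₀ F θ) (li F θ)).u3Objects θ.γ)
    (h18 : S_N18 (RRec₁₃CoPH 𝔯))
    (hsch : ∀ (F : T4Family) (θ : Stage13HParams F N), θ.Provisos₁₃CoPH F N → θ.Admissible F N → ∀ (k : ℕ),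
      ∃ (Dk : Set ℂ) (Adm : (m : ℕ) → Set (OlderTerms (F.P k) (MatA N) θ.τ9.M m)),
        IsOpen Dk ∧ (∀ z ∈ Dk, conj z ∈ Dk) ∧ (∀ t ∈ Ioc (0 : ℝ) θ.γ, closedBall (t : ℂ) (li F θ).r ⊆ Dk) ∧
        (∀ g : ℕ → ℂ, (∀ n, g n ∈ Dk) → ∀ m < k, olderOf (recTerm (G F θ k) g) m ∈ Adm m) ∧
        (∀ m < k, (G F θ k m).AnalyticInLast Dk (Adm m) (sp F θ k (m + 1))) ∧
        (∀ m < k, (G F θ k m).PropagatesAnalyticity Dk (Adm m) (fun j : Fin (m + 1) => sp F θ k j) (sp F θ k (m + 1))) ∧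
        (∀ g ∈ Window θ.γ, ∀ (i j : ℕ), i < j → j ≤ k → ∀ (X : (domSys (F.P k) θ.τ9.M j).Dom), ∀ φ ∈ sp F θ k j X, ∀ z ∈ Dk,
          ‖recTerm (G F θ k) (Function.update (fun n => ((g n : ℝ) : ℂ)) i z) j X φ‖ ≤
            (li F θ).A * (li F θ).μ ^ (j - 1 - i) * Real.exp (-((li F θ).κ * (domSys (F.P k) θ.τ9.M j).dj X))))
    (hnum : ∀ (F : T4Family) (θ : Stage13HParams F N), θ.Provisos₁₃CoPH F N → θ.Admissible F N →
      0 < (li F θ).C₀ ∧ 0 < (li F θ).θ₅ ∧ (li F θ).θ₅ < 1 ∧ 0 ≤ (li F θ).C₅ ∧ 2 * (li F θ).C₅ / (1 - (li F θ).θ₅) ≤ (li F θ).C₀ ∧ 0 < (li F θ).A ∧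
        (li F θ).θ₅ ≤ (li F θ).μ ∧ (li F θ).C₀ ≤ 2 * (li F θ).A ∧ 0 < (li F θ).r ∧ 0 < (li F θ).s ∧ (li F θ).s < 1) :
    S_N22 (RRec₁₃CoPH 𝔯) := by
  rw [s_N22_rRec₁₃CoPH_w1_iff 𝔯 (fun F θ => ReadingData.ofRecordAdm F θ.τ9.M N (runTowers fun k => toClusterTower (G F θ k)) (sp F θ) (gauge F θ) (hg F θ) (T₀ F θ) (hT₀ F θ) (li F θ)) hpin]
  rw [s_N18_rRec₁₃CoPH_iff] at h18
  intro F D h k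
  refine n22At_u3OfRecord₁₃_ofRecordAdm_gen_of_n18Below_schemasBelow h.params.toStage13Params (G F h.params) (sp F h.params) (gauge F h.params) (hg F h.params)
    (T₀ F h.params) (hT₀ F h.params) (li F h.params) k (fun k' _ => ?_) (hsch F h.params h.provisos h.admissible k)
    (hnum F h.params h.provisos h.admissible) h.gamma_pos
  have h18' := h18 F D h (fun _ => 0) [] k'
  rw [hpin] at h18'
  exact h18'

/-- **THE SAME AT THE REGIME ∕ TUPLE HOME** `RRec₁₃CoPHOn 𝔯 Rg` (any `Rg`; `Node00.unityNondeg₁₃H N` is rev 16's ∕ rev 22's ∕ rev 24's binder prefix). [folklore] -/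
theorem s_N22_rRec₁₃CoPHOn_w1_gen_of_s_N18_schemasBelow (𝔯 : RateReading₁₃CoPH N) (Rg : (F : T4Family) → Stage13HParams F N → Prop)
    (hpin : ∀ (F : T4Family) (θ : Stage13HParams F N) (hP : θ.Provisos₁₃CoPH F N) (g₀ : ℕ → ℝ) (os : List (ULoop F)), (𝔯.lit F θ hP g₀ os).u3 =
      (ReadingData.ofRecordAdm F θ.τ9.M N (runTowers fun k => toClusterTower (G F θ k)) (sp F θ) (gauge F θ) (hg F θ) (T₀ F θ) (hT₀ F θ) (li F θ)).u3Objects θ.γ)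
    (h18 : S_N18 (RRec₁₃CoPHOn 𝔯 Rg))
    (hsch : ∀ (F : T4Family) (θ : Stage13HParams F N), θ.Provisos₁₃CoPH F N → Rg F θ → θ.Admissible F N → ∀ (k : ℕ),
      ∃ (Dk : Set ℂ) (Adm : (m : ℕ) → Set (OlderTerms (F.P k) (MatA N) θ.τ9.M m)),
        IsOpen Dk ∧ (∀ z ∈ Dk, conj z ∈ Dk) ∧ (∀ t ∈ Ioc (0 : ℝ) θ.γ, closedBall (t : ℂ) (li F θ).r ⊆ Dk) ∧
        (∀ g : ℕ → ℂ, (∀ n, g n ∈ Dk) → ∀ m < k, olderOf (recTerm (G F θ k) g) m ∈ Adm m) ∧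
        (∀ m < k, (G F θ k m).AnalyticInLast Dk (Adm m) (sp F θ k (m + 1))) ∧
        (∀ m < k, (G F θ k m).PropagatesAnalyticity Dk (Adm m) (fun j : Fin (m + 1) => sp F θ k j) (sp F θ k (m + 1))) ∧
        (∀ g ∈ Window θ.γ, ∀ (i j : ℕ), i < j → j ≤ k → ∀ (X : (domSys (F.P k) θ.τ9.M j).Dom), ∀ φ ∈ sp F θ k j X, ∀ z ∈ Dk,
          ‖recTerm (G F θ k) (Function.update (fun n => ((g n : ℝ) : ℂ)) i z) j X φ‖ ≤
            (li F θ).A * (li F θ).μ ^ (j - 1 - i) * Real.exp (-((li F θ).κ * (domSys (F.P k) θ.τ9.M j).dj X))))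
    (hnum : ∀ (F : T4Family) (θ : Stage13HParams F N), θ.Provisos₁₃CoPH F N → Rg F θ → θ.Admissible F N →
      0 < (li F θ).C₀ ∧ 0 < (li F θ).θ₅ ∧ (li F θ).θ₅ < 1 ∧ 0 ≤ (li F θ).C₅ ∧ 2 * (li F θ).C₅ / (1 - (li F θ).θ₅) ≤ (li F θ).C₀ ∧ 0 < (li F θ).A ∧
        (li F θ).θ₅ ≤ (li F θ).μ ∧ (li F θ).C₀ ≤ 2 * (li F θ).A ∧ 0 < (li F θ).r ∧ 0 < (li F θ).s ∧ (li F θ).s < 1) :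
    S_N22 (RRec₁₃CoPHOn 𝔯 Rg) := by
  rw [s_N22_rRec₁₃CoPHOn_iff]
  rw [s_N18_rRec₁₃CoPHOn_iff] at h18
  intro F θ hP hRg hθ g₀ os k
  rw [hpin F θ hP g₀ os]
  refine n22At_u3OfRecord₁₃_ofRecordAdm_gen_of_n18Below_schemasBelow θ.toStage13Params (G F θ) (sp F θ) (gauge F θ) (hg F θ) (T₀ F θ) (hT₀ F θ) (li F θ) k
    (fun k' _ => ?_) (hsch F θ hP hRg hθ k) (hnum F θ hP hRg hθ) hθ.toStage9.gamma_pos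
  have h18' := h18 F θ hP hRg hθ g₀ os k'
  rw [hpin] at h18'
  exact h18'

variable (ℓ₃ : T4Family → NE3Letters₁₁) (ne2 : (F : T4Family) → Stage13HParams F N → (ℕ → ℝ) → List (ULoop F) → ℕ → NE2Objects₁₁)

/-- **THE SAME AT THE STAGE-13 READING OF RECORD, EDITION 1, CANONICAL HOME** (module 6″'s `readingOfRecord₁₃CoPH` with the admissible W1 component on the generated run towers;
`hpin := rfl`). [folklore] -/
theorem s_N22_readingOfRecord₁₃CoPH_gen_of_s_N18_schemasBelow
    (h18 : S_N18 (RRec₁₃CoPH (readingOfRecord₁₃CoPH (fun F θ => ReadingData.ofRecordAdm F θ.τ9.M N (runTowers fun k => toClusterTower (G F θ k)) (sp F θ) (gauge F θ) (hg F θ) (T₀ F θ) (hT₀ F θ) (li F θ)) ℓ₃ ne2 ne1)))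
    (hsch : ∀ (F : T4Family) (θ : Stage13HParams F N), θ.Provisos₁₃CoPH F N → θ.Admissible F N → ∀ (k : ℕ),
      ∃ (Dk : Set ℂ) (Adm : (m : ℕ) → Set (OlderTerms (F.P k) (MatA N) θ.τ9.M m)),
        IsOpen Dk ∧ (∀ z ∈ Dk, conj z ∈ Dk) ∧ (∀ t ∈ Ioc (0 : ℝ) θ.γ, closedBall (t : ℂ) (li F θ).r ⊆ Dk) ∧
        (∀ g : ℕ → ℂ, (∀ n, g n ∈ Dk) → ∀ m < k, olderOf (recTerm (G F θ k) g) m ∈ Adm m) ∧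
        (∀ m < k, (G F θ k m).AnalyticInLast Dk (Adm m) (sp F θ k (m + 1))) ∧
        (∀ m < k, (G F θ k m).PropagatesAnalyticity Dk (Adm m) (fun j : Fin (m + 1) => sp F θ k j) (sp F θ k (m + 1))) ∧
        (∀ g ∈ Window θ.γ, ∀ (i j : ℕ), i < j → j ≤ k → ∀ (X : (domSys (F.P k) θ.τ9.M j).Dom), ∀ φ ∈ sp F θ k j X, ∀ z ∈ Dk,
          ‖recTerm (G F θ k) (Function.update (fun n => ((g n : ℝ) : ℂ)) i z) j X φ‖ ≤
            (li F θ).A * (li F θ).μ ^ (j - 1 - i) * Real.exp (-((li F θ).κ * (domSys (F.P k) θ.τ9.M j).dj X))))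
    (hnum : ∀ (F : T4Family) (θ : Stage13HParams F N), θ.Provisos₁₃CoPH F N → θ.Admissible F N →
      0 < (li F θ).C₀ ∧ 0 < (li F θ).θ₅ ∧ (li F θ).θ₅ < 1 ∧ 0 ≤ (li F θ).C₅ ∧ 2 * (li F θ).C₅ / (1 - (li F θ).θ₅) ≤ (li F θ).C₀ ∧ 0 < (li F θ).A ∧
        (li F θ).θ₅ ≤ (li F θ).μ ∧ (li F θ).C₀ ≤ 2 * (li F θ).A ∧ 0 < (li F θ).r ∧ 0 < (li F θ).s ∧ (li F θ).s < 1) :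
    S_N22 (RRec₁₃CoPH (readingOfRecord₁₃CoPH (fun F θ => ReadingData.ofRecordAdm F θ.τ9.M N (runTowers fun k => toClusterTower (G F θ k)) (sp F θ) (gauge F θ) (hg F θ) (T₀ F θ) (hT₀ F θ) (li F θ)) ℓ₃ ne2 ne1)) :=
  s_N22_rRec₁₃CoPH_w1_gen_of_s_N18_schemasBelow G sp gauge hg T₀ hT₀ li _ (fun _ _ _ _ _ => rfl) h18 hsch hnum

/-- **THE SAME AT THE STAGE-13 READING OF RECORD, EDITION 1, REGIME ∕ TUPLE HOME** (any `Rg`; `hpin := rfl`). [folklore] -/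
theorem s_N22_readingOfRecord₁₃CoPHOn_gen_of_s_N18_schemasBelow (Rg : (F : T4Family) → Stage13HParams F N → Prop)
    (h18 : S_N18 (RRec₁₃CoPHOn (readingOfRecord₁₃CoPH (fun F θ => ReadingData.ofRecordAdm F θ.τ9.M N (runTowers fun k => toClusterTower (G F θ k)) (sp F θ) (gauge F θ) (hg F θ) (T₀ F θ) (hT₀ F θ) (li F θ)) ℓ₃ ne2 ne1) Rg))
    (hsch : ∀ (F : T4Family) (θ : Stage13HParams F N), θ.Provisos₁₃CoPH F N → Rg F θ → θ.Admissible F N → ∀ (k : ℕ),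
      ∃ (Dk : Set ℂ) (Adm : (m : ℕ) → Set (OlderTerms (F.P k) (MatA N) θ.τ9.M m)),
        IsOpen Dk ∧ (∀ z ∈ Dk, conj z ∈ Dk) ∧ (∀ t ∈ Ioc (0 : ℝ) θ.γ, closedBall (t : ℂ) (li F θ).r ⊆ Dk) ∧
        (∀ g : ℕ → ℂ, (∀ n, g n ∈ Dk) → ∀ m < k, olderOf (recTerm (G F θ k) g) m ∈ Adm m) ∧
        (∀ m < k, (G F θ k m).AnalyticInLast Dk (Adm m) (sp F θ k (m + 1))) ∧
        (∀ m < k, (G F θ k m).PropagatesAnalyticity Dk (Adm m) (fun j : Fin (m + 1) => sp F θ k j) (sp F θ k (m + 1))) ∧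
        (∀ g ∈ Window θ.γ, ∀ (i j : ℕ), i < j → j ≤ k → ∀ (X : (domSys (F.P k) θ.τ9.M j).Dom), ∀ φ ∈ sp F θ k j X, ∀ z ∈ Dk,
          ‖recTerm (G F θ k) (Function.update (fun n => ((g n : ℝ) : ℂ)) i z) j X φ‖ ≤
            (li F θ).A * (li F θ).μ ^ (j - 1 - i) * Real.exp (-((li F θ).κ * (domSys (F.P k) θ.τ9.M j).dj X))))
    (hnum : ∀ (F : T4Family) (θ : Stage13HParams F N), θ.Provisos₁₃CoPH F N → Rg F θ → θ.Admissible F N →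
      0 < (li F θ).C₀ ∧ 0 < (li F θ).θ₅ ∧ (li F θ).θ₅ < 1 ∧ 0 ≤ (li F θ).C₅ ∧ 2 * (li F θ).C₅ / (1 - (li F θ).θ₅) ≤ (li F θ).C₀ ∧ 0 < (li F θ).A ∧
        (li F θ).θ₅ ≤ (li F θ).μ ∧ (li F θ).C₀ ≤ 2 * (li F θ).A ∧ 0 < (li F θ).r ∧ 0 < (li F θ).s ∧ (li F θ).s < 1) :
    S_N22 (RRec₁₃CoPHOn (readingOfRecord₁₃CoPH (fun F θ => ReadingData.ofRecordAdm F θ.τ9.M N (runTowers fun k => toClusterTower (G F θ k)) (sp F θ) (gauge F θ) (hg F θ) (T₀ F θ) (hT₀ F θ) (li F θ)) ℓ₃ ne2 ne1) Rg) :=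
  s_N22_rRec₁₃CoPHOn_w1_gen_of_s_N18_schemasBelow G sp gauge hg T₀ hT₀ li _ Rg (fun _ _ _ _ _ => rfl) h18 hsch hnum

end Stub

section GenStub

variable (G : (F : T4Family) → (θ : Stage13HParams F N) → (k : ℕ) → GenTower (F.P k) (MatA N) θ.τ9.M)
  (Pplus : (F : T4Family) → (θ : Stage13HParams F N) → (k : ℕ) → GaugeField (F.P k) 0 (Node00.SU N) → Prop)
  (T₀ : (F : T4Family) → (θ : Stage13HParams F N) → (k : ℕ) → GaugeField (F.P (k + 1)) 0 (Node00.SU N) → GaugeField (F.P k) 0 (Node00.SU N))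
  (gauge : (F : T4Family) → (θ : Stage13HParams F N) → (k : ℕ) → GaugeField (F.P k) 0 (Node00.SU N) → GaugeField (F.P k) 0 (Node00.SU N) → ℝ)
  (hg : ∀ (F : T4Family) (θ : Stage13HParams F N) (k : ℕ) (U U' : GaugeField (F.P k) 0 (Node00.SU N)), 0 ≤ gauge F θ k U U')
  (li : (F : T4Family) → Stage13HParams F N → LetterInputs) (ℓ₃ : T4Family → NE3Letters₁₁)
  (ne2 : (F : T4Family) → Stage13HParams F N → (ℕ → ℝ) → List (ULoop F) → ℕ → NE2Objects₁₁)
  (ne1 : (F : T4Family) → Stage13HParams F N → (ℕ → ℝ) → List (ULoop F) → NE1pCarriers)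

/-- **`S_N22` AT THE STAGE-13 READING OF RECORD WHOSE W1 COMPONENT IS `ReadingData.ofRecordGen` ON THE GENERATED RUN TOWERS** (canonical home): `S_N18` at the same reading +
the sharp schema package at the generated tables per admissible Stage-13 tuple with provisos and run length + numerals ⟹ `S_N22` — the `ofRecordAdm` face at `spGen` ∕ `hT₀_spGen`
(`ofRecordGen` IS `ofRecordAdm` there, `rfl`).  NO transport clause, NO coherence, NO (J), NO readings clause. [folklore] -/
theorem s_N22_readingOfRecord₁₃CoPH_ofRecordGen_gen_of_s_N18_schemasBelow
    (h18 : S_N18 (RRec₁₃CoPH (readingOfRecord₁₃CoPH (fun F θ => ReadingData.ofRecordGen F θ.τ9.M N (Pplus F θ) (T₀ F θ) (runTowers fun k => toClusterTower (G F θ k)) (gauge F θ) (hg F θ) (li F θ)) ℓ₃ ne2 ne1)))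
    (hsch : ∀ (F : T4Family) (θ : Stage13HParams F N), θ.Provisos₁₃CoPH F N → θ.Admissible F N → ∀ (k : ℕ),
      ∃ (Dk : Set ℂ) (Adm : (m : ℕ) → Set (OlderTerms (F.P k) (MatA N) θ.τ9.M m)),
        IsOpen Dk ∧ (∀ z ∈ Dk, conj z ∈ Dk) ∧ (∀ t ∈ Ioc (0 : ℝ) θ.γ, closedBall (t : ℂ) (li F θ).r ⊆ Dk) ∧
        (∀ g : ℕ → ℂ, (∀ n, g n ∈ Dk) → ∀ m < k, olderOf (recTerm (G F θ k) g) m ∈ Adm m) ∧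
        (∀ m < k, (G F θ k m).AnalyticInLast Dk (Adm m) (spGen F θ.τ9.M N (Pplus F θ) (T₀ F θ) k (m + 1))) ∧
        (∀ m < k, (G F θ k m).PropagatesAnalyticity Dk (Adm m) (fun j : Fin (m + 1) => spGen F θ.τ9.M N (Pplus F θ) (T₀ F θ) k j) (spGen F θ.τ9.M N (Pplus F θ) (T₀ F θ) k (m + 1))) ∧
        (∀ g ∈ Window θ.γ, ∀ (i j : ℕ), i < j → j ≤ k → ∀ (X : (domSys (F.P k) θ.τ9.M j).Dom), ∀ φ ∈ spGen F θ.τ9.M N (Pplus F θ) (T₀ F θ) k j X, ∀ z ∈ Dk,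
          ‖recTerm (G F θ k) (Function.update (fun n => ((g n : ℝ) : ℂ)) i z) j X φ‖ ≤
            (li F θ).A * (li F θ).μ ^ (j - 1 - i) * Real.exp (-((li F θ).κ * (domSys (F.P k) θ.τ9.M j).dj X))))
    (hnum : ∀ (F : T4Family) (θ : Stage13HParams F N), θ.Provisos₁₃CoPH F N → θ.Admissible F N →
      0 < (li F θ).C₀ ∧ 0 < (li F θ).θ₅ ∧ (li F θ).θ₅ < 1 ∧ 0 ≤ (li F θ).C₅ ∧ 2 * (li F θ).C₅ / (1 - (li F θ).θ₅) ≤ (li F θ).C₀ ∧ 0 < (li F θ).A ∧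
        (li F θ).θ₅ ≤ (li F θ).μ ∧ (li F θ).C₀ ≤ 2 * (li F θ).A ∧ 0 < (li F θ).r ∧ 0 < (li F θ).s ∧ (li F θ).s < 1) :
    S_N22 (RRec₁₃CoPH (readingOfRecord₁₃CoPH (fun F θ => ReadingData.ofRecordGen F θ.τ9.M N (Pplus F θ) (T₀ F θ) (runTowers fun k => toClusterTower (G F θ k)) (gauge F θ) (hg F θ) (li F θ)) ℓ₃ ne2 ne1)) :=
  s_N22_rRec₁₃CoPH_w1_gen_of_s_N18_schemasBelow G (fun F θ => spGen F θ.τ9.M N (Pplus F θ) (T₀ F θ)) gauge hg T₀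
    (fun F θ => hT₀_spGen F θ.τ9.M N (Pplus F θ) (T₀ F θ)) li _ (fun _ _ _ _ _ => rfl) h18 hsch hnum

/-- **THE SAME AT THE REGIME ∕ TUPLE HOME** (any `Rg`; at `Rg := Node00.unityNondeg₁₃H N` this is rev 16's ∕ rev 22's ∕ rev 24's binder prefix «`(θ.ZhUnity F N ∧ θ.SlotsNondegenerate₁₃ F N) →
θ.Admissible F N → …`» read at the reading of record on the generated towers). [folklore] -/
theorem s_N22_readingOfRecord₁₃CoPHOn_ofRecordGen_gen_of_s_N18_schemasBelow (Rg : (F : T4Family) → Stage13HParams F N → Prop)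
    (h18 : S_N18 (RRec₁₃CoPHOn (readingOfRecord₁₃CoPH (fun F θ => ReadingData.ofRecordGen F θ.τ9.M N (Pplus F θ) (T₀ F θ) (runTowers fun k => toClusterTower (G F θ k)) (gauge F θ) (hg F θ) (li F θ)) ℓ₃ ne2 ne1) Rg))
    (hsch : ∀ (F : T4Family) (θ : Stage13HParams F N), θ.Provisos₁₃CoPH F N → Rg F θ → θ.Admissible F N → ∀ (k : ℕ),
      ∃ (Dk : Set ℂ) (Adm : (m : ℕ) → Set (OlderTerms (F.P k) (MatA N) θ.τ9.M m)),
        IsOpen Dk ∧ (∀ z ∈ Dk, conj z ∈ Dk) ∧ (∀ t ∈ Ioc (0 : ℝ) θ.γ, closedBall (t : ℂ) (li F θ).r ⊆ Dk) ∧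
        (∀ g : ℕ → ℂ, (∀ n, g n ∈ Dk) → ∀ m < k, olderOf (recTerm (G F θ k) g) m ∈ Adm m) ∧
        (∀ m < k, (G F θ k m).AnalyticInLast Dk (Adm m) (spGen F θ.τ9.M N (Pplus F θ) (T₀ F θ) k (m + 1))) ∧
        (∀ m < k, (G F θ k m).PropagatesAnalyticity Dk (Adm m) (fun j : Fin (m + 1) => spGen F θ.τ9.M N (Pplus F θ) (T₀ F θ) k j) (spGen F θ.τ9.M N (Pplus F θ) (T₀ F θ) k (m + 1))) ∧
        (∀ g ∈ Window θ.γ, ∀ (i j : ℕ), i < j → j ≤ k → ∀ (X : (domSys (F.P k) θ.τ9.M j).Dom), ∀ φ ∈ spGen F θ.τ9.M N (Pplus F θ) (T₀ F θ) k j X, ∀ z ∈ Dk,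
          ‖recTerm (G F θ k) (Function.update (fun n => ((g n : ℝ) : ℂ)) i z) j X φ‖ ≤
            (li F θ).A * (li F θ).μ ^ (j - 1 - i) * Real.exp (-((li F θ).κ * (domSys (F.P k) θ.τ9.M j).dj X))))
    (hnum : ∀ (F : T4Family) (θ : Stage13HParams F N), θ.Provisos₁₃CoPH F N → Rg F θ → θ.Admissible F N →
      0 < (li F θ).C₀ ∧ 0 < (li F θ).θ₅ ∧ (li F θ).θ₅ < 1 ∧ 0 ≤ (li F θ).C₅ ∧ 2 * (li F θ).C₅ / (1 - (li F θ).θ₅) ≤ (li F θ).C₀ ∧ 0 < (li F θ).A ∧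
        (li F θ).θ₅ ≤ (li F θ).μ ∧ (li F θ).C₀ ≤ 2 * (li F θ).A ∧ 0 < (li F θ).r ∧ 0 < (li F θ).s ∧ (li F θ).s < 1) :
    S_N22 (RRec₁₃CoPHOn (readingOfRecord₁₃CoPH (fun F θ => ReadingData.ofRecordGen F θ.τ9.M N (Pplus F θ) (T₀ F θ) (runTowers fun k => toClusterTower (G F θ k)) (gauge F θ) (hg F θ) (li F θ)) ℓ₃ ne2 ne1) Rg) :=
  s_N22_rRec₁₃CoPHOn_w1_gen_of_s_N18_schemasBelow G (fun F θ => spGen F θ.τ9.M N (Pplus F θ) (T₀ F θ)) gauge hg T₀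
    (fun F θ => hT₀_spGen F θ.τ9.M N (Pplus F θ) (T₀ F θ)) li _ Rg (fun _ _ _ _ _ => rfl) h18 hsch hnum

end GenStub

/-! ## §4 IN THE K3‴ SKELETON'S OWN CURRENCY: N22's conjunct of `KeyedRates rr` at the LEVEL-SELECTED tuple reading of record (plan g66 `D66-REV16/K3Skeleton13.lean`:
`rr : RateReading 2`, `KeyedRates rr := ∀ F θ hP, θ.Admissible F N → ∀ g₀ os, RatesAt (datumOfRecord₁₃CoPH F N θ hP) (rr F θ hP g₀ os)`, N22's conjunct = `N22At (rr …).u3`;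
the home's witness `rr F θ hP g₀ os := rateCarriersOfRecord₁₃CoPH (readingOfRecord₁₃CoPH …) F θ hP g₀ os (ksel F θ g₀ os)` of 5″ §5) -/

section TupleReading

variable (G : (F : T4Family) → (θ : Stage13HParams F N) → (k : ℕ) → GenTower (F.P k) (MatA N) θ.τ9.M)
  (sp : (F : T4Family) → (θ : Stage13HParams F N) → (k j : ℕ) → (domSys (F.P k) θ.τ9.M j).Dom → Set (CPair (F.P k) (MatA N)))
  (gauge : (F : T4Family) → (θ : Stage13HParams F N) → (k : ℕ) → GaugeField (F.P k) 0 (Node00.SU N) → GaugeField (F.P k) 0 (Node00.SU N) → ℝ)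
  (hg : ∀ (F : T4Family) (θ : Stage13HParams F N) (k : ℕ) (U U' : GaugeField (F.P k) 0 (Node00.SU N)), 0 ≤ gauge F θ k U U')
  (T₀ : (F : T4Family) → (θ : Stage13HParams F N) → (k : ℕ) → GaugeField (F.P (k + 1)) 0 (Node00.SU N) → GaugeField (F.P k) 0 (Node00.SU N))
  (hT₀ : ∀ (F : T4Family) (θ : Stage13HParams F N) (k : ℕ) (U : GaugeField (F.P (k + 1)) 0 (Node00.SU N)),
    (∀ (j : ℕ) (Y : (domSys (F.P (k + 1)) θ.τ9.M j).Dom), ofBackgroundC (ιSU N) U ∈ sp F θ (k + 1) j Y) →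
    ∀ (j : ℕ) (Y : (domSys (F.P k) θ.τ9.M j).Dom), ofBackgroundC (ιSU N) (T₀ F θ k U) ∈ sp F θ k j Y)
  (li : (F : T4Family) → Stage13HParams F N → LetterInputs) (ℓ₃ : T4Family → NE3Letters₁₁)
  (ne2 : (F : T4Family) → Stage13HParams F N → (ℕ → ℝ) → List (ULoop F) → ℕ → NE2Objects₁₁)
  (ne1 : (F : T4Family) → Stage13HParams F N → (ℕ → ℝ) → List (ULoop F) → NE1pCarriers)
  (ksel : (F : T4Family) → Stage13HParams F N → (ℕ → ℝ) → List (ULoop F) → ℕ)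

/-- **N22's CONJUNCT OF `KeyedRates rr` AT THE LEVEL-SELECTED TUPLE READING OF RECORD ON THE GENERATED ADMISSIBLE TOWERS** (the skeleton's unguarded binder
«`∀ F θ hP, θ.Admissible F N → ∀ g₀ os, N22At (rr F θ hP g₀ os).u3`» for `rr F θ hP g₀ os := rateCarriersOfRecord₁₃CoPH (readingOfRecord₁₃CoPH …) F θ hP g₀ os (ksel F θ g₀ os)`): node N18
at the run lengths BELOW the selected one at the same reading + the sharp schema package at the selected run length + numerals ⟹ the conjunct — §1's θ-form once per admissible
tuple (`readingOfRecord₁₃CoPH_bundle_u3`, `rfl`).  The K3‴ composer conjoins this with the other five nodes' conjuncts at the same `rr`. [folklore] -/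
theorem n22_tupleReadingOfRecordCoPH_gen_of_n18Below_schemasBelow
    (h18 : ∀ (F : T4Family) (θ : Stage13HParams F N) (hP : θ.Provisos₁₃CoPH F N), θ.Admissible F N → ∀ (g₀ : ℕ → ℝ) (os : List (ULoop F)),
      ∀ k' : ℕ, k' < ksel F θ g₀ os → N18At (u3OfRecord₁₃ θ.toStage13Params ((ReadingData.ofRecordAdm F θ.τ9.M N (runTowers fun k => toClusterTower (G F θ k)) (sp F θ) (gauge F θ) (hg F θ) (T₀ F θ) (hT₀ F θ) (li F θ)).u3Objects θ.γ) k'))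
    (hsch : ∀ (F : T4Family) (θ : Stage13HParams F N), θ.Provisos₁₃CoPH F N → θ.Admissible F N → ∀ (g₀ : ℕ → ℝ) (os : List (ULoop F)),
      ∃ (Dk : Set ℂ) (Adm : (m : ℕ) → Set (OlderTerms (F.P (ksel F θ g₀ os)) (MatA N) θ.τ9.M m)),
        IsOpen Dk ∧ (∀ z ∈ Dk, conj z ∈ Dk) ∧ (∀ t ∈ Ioc (0 : ℝ) θ.γ, closedBall (t : ℂ) (li F θ).r ⊆ Dk) ∧
        (∀ g : ℕ → ℂ, (∀ n, g n ∈ Dk) → ∀ m < ksel F θ g₀ os, olderOf (recTerm (G F θ (ksel F θ g₀ os)) g) m ∈ Adm m) ∧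
        (∀ m < ksel F θ g₀ os, (G F θ (ksel F θ g₀ os) m).AnalyticInLast Dk (Adm m) (sp F θ (ksel F θ g₀ os) (m + 1))) ∧
        (∀ m < ksel F θ g₀ os, (G F θ (ksel F θ g₀ os) m).PropagatesAnalyticity Dk (Adm m) (fun j : Fin (m + 1) => sp F θ (ksel F θ g₀ os) j)
          (sp F θ (ksel F θ g₀ os) (m + 1))) ∧
        (∀ g ∈ Window θ.γ, ∀ (i j : ℕ), i < j → j ≤ ksel F θ g₀ os → ∀ (X : (domSys (F.P (ksel F θ g₀ os)) θ.τ9.M j).Dom),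
          ∀ φ ∈ sp F θ (ksel F θ g₀ os) j X, ∀ z ∈ Dk,
            ‖recTerm (G F θ (ksel F θ g₀ os)) (Function.update (fun n => ((g n : ℝ) : ℂ)) i z) j X φ‖ ≤
              (li F θ).A * (li F θ).μ ^ (j - 1 - i) * Real.exp (-((li F θ).κ * (domSys (F.P (ksel F θ g₀ os)) θ.τ9.M j).dj X))))
    (hnum : ∀ (F : T4Family) (θ : Stage13HParams F N), θ.Provisos₁₃CoPH F N → θ.Admissible F N →
      0 < (li F θ).C₀ ∧ 0 < (li F θ).θ₅ ∧ (li F θ).θ₅ < 1 ∧ 0 ≤ (li F θ).C₅ ∧ 2 * (li F θ).C₅ / (1 - (li F θ).θ₅) ≤ (li F θ).C₀ ∧ 0 < (li F θ).A ∧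
        (li F θ).θ₅ ≤ (li F θ).μ ∧ (li F θ).C₀ ≤ 2 * (li F θ).A ∧ 0 < (li F θ).r ∧ 0 < (li F θ).s ∧ (li F θ).s < 1) :
    ∀ (F : T4Family) (θ : Stage13HParams F N) (hP : θ.Provisos₁₃CoPH F N), θ.Admissible F N → ∀ (g₀ : ℕ → ℝ) (os : List (ULoop F)),
      N22At (rateCarriersOfRecord₁₃CoPH (readingOfRecord₁₃CoPH (fun F θ => ReadingData.ofRecordAdm F θ.τ9.M N (runTowers fun k => toClusterTower (G F θ k)) (sp F θ) (gauge F θ) (hg F θ) (T₀ F θ) (hT₀ F θ) (li F θ)) ℓ₃ ne2 ne1) F θ hP g₀ os (ksel F θ g₀ os)).u3 :=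
  fun F θ hP hθ g₀ os =>
    n22At_u3OfRecord₁₃_ofRecordAdm_gen_of_n18Below_schemasBelow θ.toStage13Params (G F θ) (sp F θ) (gauge F θ) (hg F θ) (T₀ F θ) (hT₀ F θ) (li F θ) (ksel F θ g₀ os)
      (h18 F θ hP hθ g₀ os) (hsch F θ hP hθ g₀ os) (hnum F θ hP hθ) hθ.toStage9.gamma_pos

/-- **… AND GUARDED** (rev 16's ∕ rev 22's ∕ rev 24's binder prefix: the conjunct is asked only of the tuples with `(θ.ZhUnity F N ∧ θ.SlotsNondegenerate₁₃ F N)`, i.e. in RR-2's guard of record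
`Node00.unityNondeg₁₃H N`, or any regime `Rg`; every hypothesis asked only there). [folklore] -/
theorem n22_tupleReadingOfRecordCoPHOn_gen_of_n18Below_schemasBelow (Rg : (F : T4Family) → Stage13HParams F N → Prop)
    (h18 : ∀ (F : T4Family) (θ : Stage13HParams F N) (hP : θ.Provisos₁₃CoPH F N), Rg F θ → θ.Admissible F N → ∀ (g₀ : ℕ → ℝ) (os : List (ULoop F)),
      ∀ k' : ℕ, k' < ksel F θ g₀ os → N18At (u3OfRecord₁₃ θ.toStage13Params ((ReadingData.ofRecordAdm F θ.τ9.M N (runTowers fun k => toClusterTower (G F θ k)) (sp F θ) (gauge F θ) (hg F θ) (T₀ F θ) (hT₀ F θ) (li F θ)).u3Objects θ.γ) k'))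
    (hsch : ∀ (F : T4Family) (θ : Stage13HParams F N), θ.Provisos₁₃CoPH F N → Rg F θ → θ.Admissible F N → ∀ (g₀ : ℕ → ℝ) (os : List (ULoop F)),
      ∃ (Dk : Set ℂ) (Adm : (m : ℕ) → Set (OlderTerms (F.P (ksel F θ g₀ os)) (MatA N) θ.τ9.M m)),
        IsOpen Dk ∧ (∀ z ∈ Dk, conj z ∈ Dk) ∧ (∀ t ∈ Ioc (0 : ℝ) θ.γ, closedBall (t : ℂ) (li F θ).r ⊆ Dk) ∧
        (∀ g : ℕ → ℂ, (∀ n, g n ∈ Dk) → ∀ m < ksel F θ g₀ os, olderOf (recTerm (G F θ (ksel F θ g₀ os)) g) m ∈ Adm m) ∧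
        (∀ m < ksel F θ g₀ os, (G F θ (ksel F θ g₀ os) m).AnalyticInLast Dk (Adm m) (sp F θ (ksel F θ g₀ os) (m + 1))) ∧
        (∀ m < ksel F θ g₀ os, (G F θ (ksel F θ g₀ os) m).PropagatesAnalyticity Dk (Adm m) (fun j : Fin (m + 1) => sp F θ (ksel F θ g₀ os) j)
          (sp F θ (ksel F θ g₀ os) (m + 1))) ∧
        (∀ g ∈ Window θ.γ, ∀ (i j : ℕ), i < j → j ≤ ksel F θ g₀ os → ∀ (X : (domSys (F.P (ksel F θ g₀ os)) θ.τ9.M j).Dom),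
          ∀ φ ∈ sp F θ (ksel F θ g₀ os) j X, ∀ z ∈ Dk,
            ‖recTerm (G F θ (ksel F θ g₀ os)) (Function.update (fun n => ((g n : ℝ) : ℂ)) i z) j X φ‖ ≤
              (li F θ).A * (li F θ).μ ^ (j - 1 - i) * Real.exp (-((li F θ).κ * (domSys (F.P (ksel F θ g₀ os)) θ.τ9.M j).dj X))))
    (hnum : ∀ (F : T4Family) (θ : Stage13HParams F N), θ.Provisos₁₃CoPH F N → Rg F θ → θ.Admissible F N →
      0 < (li F θ).C₀ ∧ 0 < (li F θ).θ₅ ∧ (li F θ).θ₅ < 1 ∧ 0 ≤ (li F θ).C₅ ∧ 2 * (li F θ).C₅ / (1 - (li F θ).θ₅) ≤ (li F θ).C₀ ∧ 0 < (li F θ).A ∧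
        (li F θ).θ₅ ≤ (li F θ).μ ∧ (li F θ).C₀ ≤ 2 * (li F θ).A ∧ 0 < (li F θ).r ∧ 0 < (li F θ).s ∧ (li F θ).s < 1) :
    ∀ (F : T4Family) (θ : Stage13HParams F N) (hP : θ.Provisos₁₃CoPH F N), Rg F θ → θ.Admissible F N → ∀ (g₀ : ℕ → ℝ) (os : List (ULoop F)),
      N22At (rateCarriersOfRecord₁₃CoPH (readingOfRecord₁₃CoPH (fun F θ => ReadingData.ofRecordAdm F θ.τ9.M N (runTowers fun k => toClusterTower (G F θ k)) (sp F θ) (gauge F θ) (hg F θ) (T₀ F θ) (hT₀ F θ) (li F θ)) ℓ₃ ne2 ne1) F θ hP g₀ os (ksel F θ g₀ os)).u3 :=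
  fun F θ hP hRg hθ g₀ os =>
    n22At_u3OfRecord₁₃_ofRecordAdm_gen_of_n18Below_schemasBelow θ.toStage13Params (G F θ) (sp F θ) (gauge F θ) (hg F θ) (T₀ F θ) (hT₀ F θ) (li F θ) (ksel F θ g₀ os)
      (h18 F θ hP hRg hθ g₀ os) (hsch F θ hP hRg hθ g₀ os) (hnum F θ hP hRg hθ) hθ.toStage9.gamma_pos

end TupleReading

end YMDAG.N22

end
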